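import Summits.Ventures.PercRepro.C025ProfilePLDUniformTwoLiftTwelve

/-!
# LINES AT RANK ≤ 12 (BASE 5): (PLD)-MATROIDS OF RANK ≤ 12 ⊕ A LINE WITH ≥ 5 POINTS ⊕ FREE POINTS (night-3 g35)

`proofs/NIGHT3-G35-BASEMAP.md` §2.  With `PLDTwoLiftGen.pld_disjointSum_uniform_two_ge_5_of_eRank_le_12` — (PLD)(M) ∧ rank M ≤ 12 ⟹ (PLD)(M ⊕ U_{2,m}) for every
`m ≥ 5`; at rank 12 the base of the line tower moves to 5 (the base map of g35: `U_{2,4}` is not certifiable at rank 12, `C025ProfilePLDLineFarkasTwelve`; `U_{2,5}` is, through rank 18) — and the landed bridge `PLDBridge.rls_disjointSum_freeOn_of_pld`: C-025 at every `(p, q)` on every truncation of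
«any (PLD)-matroid of rank ≤ 12 ⊕ a line with ≥ 5 points ⊕ free points».  No `def`, no `instance`, no notation.  Axioms: standard.
-/

open scoped Matroid

namespace PercRepro

open Finset ThmH

namespace PLDTwoLiftGen

variable {α : Type} [DecidableEq α]

/-- C-025 AT EVERY `(p, q)` ON EVERY TRUNCATION OF «(PLD)-MATROID OF RANK ≤ 12 ⊕ ANY LINE WITH ≥ 5 POINTS ⊕ FREE POINTS». -/
theorem rls_truncate_disjointSum_line_freeOn_of_pld_twelve (M : Matroid α) [M.Finite] (hr : M.eRank ≤ 12)
    (hPLD : ∀ lo hi δ Θ : ℕ, Θ ≤ lo + hi + δ → (lo = 0 ∨ lo + hi + δ ≤ Θ) →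
      (∑ I ∈ (gr M).powerset, (if lo ≤ (M.eRk (I : Set α)).toNat ∧ (M.eRk (I : Set α)).toNat ≤ hi ∧
          Θ ≤ (M.eRk ((gr M \ I : Finset α) : Set α)).toNat + (M.eRk (I : Set α)).toNat then
          ((M.eRk ((gr M \ I : Finset α) : Set α)).toNat).choose δ else 0)) ≤
        ∑ I ∈ (gr M).powerset, (if lo + δ ≤ (M.eRk ((gr M \ I : Finset α) : Set α)).toNat ∧
          (M.eRk ((gr M \ I : Finset α) : Set α)).toNat ≤ hi + δ then
          ((M.eRk ((gr M \ I : Finset α) : Set α)).toNat).choose δ else 0))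
    (F : Finset α) (hF : 5 ≤ F.card) (h : Disjoint M.E (@Matroid.truncate α (Matroid.freeOn (F : Set α)) (PLDTruncate.freeOn_finite' F) 2).E)
    (E₃ : Finset α) (h₃ : Disjoint (M.disjointSum (@Matroid.truncate α (Matroid.freeOn (F : Set α)) (PLDTruncate.freeOn_finite' F) 2) h).E (E₃ : Set α)) (r p q : ℕ) :
    haveI := PLDTruncate.freeOn_finite' F
    haveI := PLDClosure.disjointSum_finite' _ _ h
    haveI := PLDBridge.disjointSum_freeOn_finite _ E₃ h₃
    ThmN.RLS (PercRepro.Matroid.truncate ((M.disjointSum (@Matroid.truncate α (Matroid.freeOn (F : Set α)) (PLDTruncate.freeOn_finite' F) 2) h).disjointSum (Matroid.freeOn (E₃ : Set α)) h₃) r) p q := by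
  haveI := PLDTruncate.freeOn_finite' F
  haveI := PLDClosure.disjointSum_finite' _ _ h
  exact PLDBridge.rls_disjointSum_freeOn_of_pld _ E₃ h₃ r p q (pld_disjointSum_uniform_two_ge_5_of_eRank_le_12 M hr hPLD F hF h)

end PLDTwoLiftGen

end PercRepro
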